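import Mathlib
import Summits.Ventures.PercRepro2.LocRows
import Summits.Ventures.PercRepro2.SwRow
import Summits.Ventures.PercRepro2.SwOut
import Summits.Ventures.PercRepro2.SwAllRow
import Summits.Ventures.PercRepro2.SwOutAll
import Summits.Ventures.PercRepro2.SwOutJunctionH1Defs
import Summits.Ventures.PercRepro2.SwOutJunctionH1EdgeDefs
import Summits.Ventures.PercRepro2.SwOutJunctionH1EdgeLift
import Summits.Ventures.PercRepro2.SwOutJunctionH1EdgeUniform

/-!
# The edge `h–u` by subdivision: `G⁺` satisfies the hypotheses of Theorem A (blind cell PercRepro2,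
night-4 g29, 2026-08-28; proofs/NIGHT4-G29.md §3)

For a junction `u` joined to `h` by the single edge `e₀`, every hypothesis of g14's
`rigidOK_of_junctionH1` holds in the subdivided graph `G⁺` with the region `U⁺ = U ∪ {w}`, the
marks `some l, some h, some o` and the junction `some u`: no loops at `h` and `u` (`subd_loop_h`,
`subd_loop_u`), `u` not adjacent to `h` (`subd_nadj`, from the uniqueness of `e₀`), every non-mark
vertex other than `u` with an outside edge or no edge (`subd_hout`: `w` has `w–l`), and the
simple-arm hypothesis (`subd_H1`: `w` is adjacent to `h`, and `w` is isolated in `G⁺[U⁺ ∖ {h, u}]`,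
`compU_subd_subset`).  Also: a uniform point of a class of `G⁺` is the uniform lift of its
restriction to `G` (`eq_ulift_of_uniform`: the class forces `w–l` to take the other colour).
-/

namespace Summit.Ventures.PercRepro2

namespace LocRows

open Hull

variable {V : Type*} {E : Type*} [DecidableEq E]

open scoped Classical

section Hyp

variable {ends : E → Sym2 V} {e₀ : E} {h u l o : V} {U : Set V}

/-- `l` is outside `U⁺`. -/
lemma subd_hl (hl : l ∉ U) : some l ∉ subdRegion U := by simpa using hl

/-- `h ≠ u` in `G⁺`. -/
lemma subd_hhu (hhu : h ≠ u) : (some h : Option V) ≠ some u :=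
  fun h' => hhu (Option.some_injective _ h')

/-- No loop at `h` in `G⁺`. -/
lemma subd_loop_h (hloop_h : ∀ e, ends e ≠ s(h, h)) (e : E ⊕ Bool) :
    subdEnds ends e₀ h u l e ≠ s(some h, some h) := by
  rcases e with e | b
  · by_cases hee : e = e₀
    · rw [hee, subdEnds_inl_self, Ne, Sym2.eq_iff]
      simp
    · exact subdEnds_inl_ne_of_ne hee (hloop_h e)
  · cases b
    · rw [subdEnds_inr_false, Ne, Sym2.eq_iff]
      simp
    · rw [subdEnds_inr_true, Ne, Sym2.eq_iff]
      simp

/-- No loop at `u` in `G⁺`. -/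
lemma subd_loop_u (hloop_u : ∀ e, ends e ≠ s(u, u)) (e : E ⊕ Bool) :
    subdEnds ends e₀ h u l e ≠ s(some u, some u) := by
  rcases e with e | b
  · by_cases hee : e = e₀
    · rw [hee, subdEnds_inl_self, Ne, Sym2.eq_iff]
      simp
    · exact subdEnds_inl_ne_of_ne hee (hloop_u e)
  · cases b
    · rw [subdEnds_inr_false, Ne, Sym2.eq_iff]
      simp
    · rw [subdEnds_inr_true, Ne, Sym2.eq_iff]
      simp

/-- `u` is not adjacent to `h` in `G⁺` when `e₀` is the only edge `h–u` of `G`. -/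
lemma subd_nadj (huniq : ∀ e, ends e = s(h, u) → e = e₀) (e : E ⊕ Bool) :
    subdEnds ends e₀ h u l e ≠ s(some h, some u) := by
  rcases e with e | b
  · by_cases hee : e = e₀
    · rw [hee, subdEnds_inl_self, Ne, Sym2.eq_iff]
      simp
    · exact subdEnds_inl_ne_of_ne hee (fun h' => hee (huniq e h'))
  · cases b
    · rw [subdEnds_inr_false, Ne, Sym2.eq_iff]
      simp
    · rw [subdEnds_inr_true, Ne, Sym2.eq_iff]
      simp

/-- A vertex `v` of `G` with no edge has no edge in `G⁺` (when `v ∉ {h, u, l}`). -/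
lemma subd_notMem_of_notMem {v : V} (hiso : ∀ e, v ∉ ends e) (hvh : v ≠ h) (hvu : v ≠ u)
    (hvl : v ≠ l) (e : E ⊕ Bool) : some v ∉ subdEnds ends e₀ h u l e := by
  rcases e with e | b
  · by_cases hee : e = e₀
    · rw [hee, subdEnds_inl_self, Sym2.mem_iff]
      simp [hvh]
    · rw [subdEnds_inl_of_ne hee, Sym2.mem_map]
      rintro ⟨a, ha, hav⟩
      exact hiso e ((Option.some_injective _ hav) ▸ ha)
  · cases b
    · rw [subdEnds_inr_false, Sym2.mem_iff]
      simp [hvu]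
    · rw [subdEnds_inr_true, Sym2.mem_iff]
      simp [hvl]

/-- **Every non-mark vertex of `U⁺` other than `u` carries an outside edge or no edge**: `w` has the
edge `w–l`, the vertices of `G` what they had. -/
lemma subd_hout (hl : l ∉ U) (he₀ : ends e₀ = s(h, u))
    (hout : ∀ x ∈ U, x ≠ h → x ≠ o → x ≠ u →
      (∃ e y, ends e = s(x, y) ∧ y ∉ U) ∨ (∀ e, x ∉ ends e)) :
    ∀ x ∈ subdRegion U, x ≠ some h → x ≠ some o → x ≠ some u →
      (∃ e y, subdEnds ends e₀ h u l e = s(x, y) ∧ y ∉ subdRegion U) ∨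
        (∀ e, x ∉ subdEnds ends e₀ h u l e) := by
  rintro (_ | v) hx hxh hxo hxu
  · exact Or.inl ⟨Sum.inr true, some l, by simp, by simpa using hl⟩
  · rw [some_mem_subdRegion_iff] at hx
    have hvh : v ≠ h := fun h' => hxh (by rw [h'])
    have hvo : v ≠ o := fun h' => hxo (by rw [h'])
    have hvu : v ≠ u := fun h' => hxu (by rw [h'])
    have hvl : v ≠ l := fun h' => hl (h' ▸ hx)
    rcases hout v hx hvh hvo hvu with ⟨e, y, hey, hyU⟩ | hiso
    · have hee : e ≠ e₀ := by
        rintro rfl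
        rw [he₀, Sym2.eq_iff] at hey
        rcases hey with ⟨h1, _⟩ | ⟨_, h2⟩
        · exact hvh h1.symm
        · exact hvu h2.symm
      exact Or.inl ⟨Sum.inl e, some y, by rw [subdEnds_inl_of_ne hee, hey, Sym2.map_mk],
        by simpa using hyU⟩
    · exact Or.inr (subd_notMem_of_notMem hiso hvh hvu hvl)

/-- `w` is isolated in `G⁺[U⁺ ∖ {h, u}]`: the component of a vertex of `G` there lies in the image of
its component in `G[U ∖ {h, u}]`. -/
lemma compU_subd_subset (hl : l ∉ U) (q : V) :
    compU (subdEnds ends e₀ h u l) (subdRegion U) (some h) (some u) (some q) ⊆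
      {y | ∃ v ∈ compU ends U h u q, y = some v} := by
  intro y hy
  refine mem_of_conn_of_closed (ends := subdEnds ends e₀ h u l)
    (ω := fun e => decide (e ∈ within (subdEnds ends e₀ h u l) (subdRegion U \ {some h, some u})))
    ?_ ⟨q, mem_cluster_self _ _ _, rfl⟩ hy
  rintro a ⟨v, hv, rfl⟩ b hab
  obtain ⟨_, e, he, hends⟩ := openGraph_adj.1 hab
  simp only [decide_eq_true_eq] at he
  obtain ⟨x, hx, y', hy', hxy⟩ := he
  rcases e with e | c
  · by_cases hee : e = e₀
    · exfalso
      rw [hee, subdEnds_inl_self, Sym2.eq_iff] at hxy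
      rcases hxy with ⟨h1, _⟩ | ⟨h1, _⟩
      · exact hx.2 (by rw [← h1]; simp)
      · exact hy'.2 (by rw [← h1]; simp)
    · obtain ⟨p', q', hpq⟩ := exists_pair_eq (ends e)
      have hsub : subdEnds ends e₀ h u l (Sum.inl e) = s(some p', some q') := by
        rw [subdEnds_inl_of_ne hee, hpq, Sym2.map_mk]
      -- the ends of `e` lie in `U ∖ {h, u}`
      have hmem : ∀ z : Option V, z ∈ subdRegion U \ {some h, some u} → ∀ z', z = some z' →
          z' ∈ U \ {h, u} := by
        rintro z ⟨hzU, hz⟩ z' rfl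
        refine ⟨by simpa using hzU, ?_⟩
        simp only [Set.mem_insert_iff, Set.mem_singleton_iff, Option.some.injEq] at hz ⊢
        exact hz
      have hopen : (fun e => decide (e ∈ within ends (U \ {h, u}))) e = true := by
        simp only [decide_eq_true_eq]
        rw [hsub, Sym2.eq_iff] at hxy
        rcases hxy with ⟨rfl, rfl⟩ | ⟨rfl, rfl⟩
        · exact ⟨p', hmem _ hx p' rfl, q', hmem _ hy' q' rfl, hpq⟩
        · exact ⟨q', hmem _ hx q' rfl, p', hmem _ hy' p' rfl, ends_swap hpq⟩
      rw [hsub, Sym2.eq_iff] at hends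
      rcases hends with ⟨h1, h2⟩ | ⟨h1, h2⟩
      · have hvp : v = p' := (Option.some_injective _ h1).symm
        subst hvp
        exact ⟨q', mem_cluster_of_edge hv hopen hpq, h2.symm⟩
      · have hvq : v = q' := (Option.some_injective _ h2).symm
        subst hvq
        exact ⟨p', mem_cluster_of_edge hv hopen (ends_swap hpq), h1.symm⟩
  · exfalso
    cases c
    · rw [subdEnds_inr_false, Sym2.eq_iff] at hxy
      rcases hxy with ⟨_, h2⟩ | ⟨_, h2⟩
      · exact hy'.2 (by rw [← h2]; simp)
      · exact hx.2 (by rw [← h2]; simp)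
    · rw [subdEnds_inr_true, Sym2.eq_iff] at hxy
      rcases hxy with ⟨_, h2⟩ | ⟨_, h2⟩
      · exact hl (by have := hy'.1; rw [← h2] at this; simpa using this)
      · exact hl (by have := hx.1; rw [← h2] at this; simpa using this)

/-- No edge of `G⁺` joins `h` to a vertex `q` of `G` that `h` is not adjacent to in `G`. -/
lemma subd_no_h_edge {q : V} (hq : ∀ e', ends e' ≠ s(h, q)) (e : E ⊕ Bool) :
    subdEnds ends e₀ h u l e ≠ s(some h, some q) := by
  rcases e with e | b
  · by_cases hee : e = e₀
    · rw [hee, subdEnds_inl_self, Ne, Sym2.eq_iff]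
      simp
    · exact subdEnds_inl_ne_of_ne hee (hq e)
  · cases b
    · rw [subdEnds_inr_false, Ne, Sym2.eq_iff]
      simp
    · rw [subdEnds_inr_true, Ne, Sym2.eq_iff]
      simp

/-- **The simple-arm hypothesis transfers to `G⁺`**: the neighbour `w` of `u` is adjacent to `h`; a
neighbour `q ≠ w` of `u` is a neighbour of `u` in `G`, adjacent to `h` or in an `h`-free component,
and the components of `G⁺[U⁺ ∖ {h, u}]` are those of `G[U ∖ {h, u}]`. -/
lemma subd_H1 (hl : l ∉ U) (hhu : h ≠ u) (hloop_u : ∀ e, ends e ≠ s(u, u))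
    (he₀ : ends e₀ = s(h, u)) (hH1 : H1 ends U h u) :
    H1 (subdEnds ends e₀ h u l) (subdRegion U) (some h) (some u) := by
  intro e p hep
  rcases e with e | b
  · by_cases hee : e = e₀
    · exfalso
      rw [hee, subdEnds_inl_self, Sym2.eq_iff] at hep
      rcases hep with ⟨h1, _⟩ | ⟨_, h2⟩
      · exact hhu (Option.some_injective _ h1)
      · exact absurd h2 (by simp)
    · obtain ⟨p', q', hpq⟩ := exists_pair_eq (ends e)
      rw [subdEnds_inl_of_ne hee, hpq, Sym2.map_mk, Sym2.eq_iff] at hep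
      -- `ends e = s(u, q)` with `p = some q`
      obtain ⟨q, hq, rfl⟩ : ∃ q, ends e = s(u, q) ∧ p = some q := by
        rcases hep with ⟨h1, h2⟩ | ⟨h1, h2⟩
        · exact ⟨q', by rw [hpq, Option.some_injective _ h1], h2.symm⟩
        · exact ⟨p', by rw [hpq, Option.some_injective _ h2, Sym2.eq_swap], h1.symm⟩
      rcases hH1 e q hq with ⟨e', he'⟩ | hfree
      · left
        have he'e₀ : e' ≠ e₀ := by
          rintro rfl
          rw [he₀, Sym2.eq_iff] at he'
          rcases he' with ⟨_, h2⟩ | ⟨_, h2⟩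
          · exact hhu h2.symm
          · exact hloop_u e (by rw [hq, ← h2])
        exact ⟨Sum.inl e', by rw [subdEnds_inl_of_ne he'e₀, he', Sym2.map_mk]⟩
      · right
        intro qq hqq e'
        obtain ⟨v, hv, rfl⟩ := compU_subd_subset hl q hqq
        exact subd_no_h_edge (hfree v hv) e'
  · left
    cases b
    · rw [subdEnds_inr_false, Sym2.eq_iff] at hep
      rcases hep with ⟨h1, _⟩ | ⟨h1, _⟩
      · exact absurd h1 (by simp)
      · exact ⟨Sum.inl e₀, by rw [subdEnds_inl_self, ← h1, Sym2.eq_swap]⟩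
    · rw [subdEnds_inr_true, Sym2.eq_iff] at hep
      rcases hep with ⟨h1, _⟩ | ⟨h1, _⟩
      · exact absurd h1 (by simp)
      · exact ⟨Sum.inl e₀, by rw [subdEnds_inl_self, ← h1, Sym2.eq_swap]⟩

end Hyp

/-! ## Uniform class points are uniform lifts -/

section Lifts

variable [Fintype E] {ends : E → Sym2 V} {e₀ : E} {h u l : V} {U : Set V}

/-- **A uniform point of a class of `G⁺` is the uniform lift of its restriction to `G`**: the class
keeps `l` out of the hull of `h`, which forces `w–l` to take the colour opposite to `h–w`. -/
theorem eq_ulift_of_uniform (hl : l ∉ U) {ξ' ζ' : Config (E ⊕ Bool)}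
    (hζ' : ζ' ∈ outClass (subdEnds ends e₀ h u l) (subdRegion U) (some h) ξ')
    (hun : Uniform e₀ ζ') : ζ' = ulift e₀ (ζ' ∘ Sum.inl) := by
  have hsub := (mem_outClass.1 hζ').2
  have hlU : some l ∉ subdRegion U := by simpa using hl
  funext e
  rcases e with e | b
  · rfl
  · cases b
    · exact hun.symm
    · simp only [ulift_inr_true, Function.comp_apply]
      cases hc : ζ' (Sum.inl e₀)
      · -- `h–w` blue: `w–l` cannot be blue
        by_contra hne
        simp only [Bool.not_false, Bool.not_eq_true] at hne
        apply hlU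
        apply hsub
        right
        have hw : (none : Option V) ∈ cluster (subdEnds ends e₀ h u l) (blue ζ') (some h) :=
          mem_cluster_of_edge (e := Sum.inl e₀) (mem_cluster_self _ _ _)
            (by rw [blue_eq_true_iff]; exact hc) (by simp)
        exact mem_cluster_of_edge (e := Sum.inr true) hw (by rw [blue_eq_true_iff]; exact hne)
          (by simp)
      · by_contra hne
        simp only [Bool.not_true, Bool.not_eq_false] at hne
        apply hlU
        apply hsub
        left
        have hw : (none : Option V) ∈ cluster (subdEnds ends e₀ h u l) ζ' (some h) :=
          mem_cluster_of_edge (e := Sum.inl e₀) (mem_cluster_self _ _ _) hc (by simp)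
        exact mem_cluster_of_edge (e := Sum.inr true) hw hne (by simp)

end Lifts

end LocRows

end Summit.Ventures.PercRepro2
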